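import Literature.MathematicalPhysics.QuantumFieldTheory.Balaban1983to89.B9Eq326LocalPartZerothOrderCoshRow
import Literature.MathematicalPhysics.QuantumFieldTheory.Balaban1983to89.B9Eq326LocalPartTowerSupDecayDiagonalClosed

/-!
# `Balaban1983to89.B9Eq326LocalPartTowerZerothOrderCoshRow` — T. Bałaban, *Propagators for lattice gauge theories in a background field*, Commun. Math. Phys.
# **99** (1985) 389–434 [Balaban1985BackgroundPropagators] (3.26) p. 395 (the local part `A₀ = Δ(U) + D_UD*_U + Q*aQ` of `Δ_a`), (3.69) p. 404 (the weighted
# sup-norm step), (3.16) p. 393, (3.10)–(3.11) p. 392, (3.49) p. 399, with [Balaban1985Variational] (134)–(136) p. 298, [Balaban1985Averaging] p. 24, (125)–(127)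
# pp. 36–37 and [Balaban1984PropagatorsI] p. 36 (the `cosh` weight): **THE ORDER-ZERO PART `P = Δ′ + Q_k(U)†(a•Q_k(U)) − κ•𝒦` OF THE TOWER LOCAL PART `A₀,k`
# CARRIES A `cosh`-WEIGHTED VALUE ROW TO A `cosh`-WEIGHTED ROW AT EVERY CENTRE OF THE TOWER's FINE TORUS `T_{(L^{n+1}m)}`, WITH AN EXPLICIT CONSTANT —
# `‖u(b)‖ ≤ N_u·W_y(b₋)` for all bonds ⟹ `‖(Pu)(b)‖ ≤ c_P·N_u·W_y(b₋)`, `c_P = p_K·e^{2θ} + k_{Q,k}·e^{θ·d·(2L^{n+1}−1)} + ‖κ‖·(d−1)·δ_𝒦·e^{2θ}`,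
# `p_K = 768·|DirPair d|·M_τ·M_φ²·(‖η^d‖∕c₀)·‖η⁻¹‖²·δ`, `δ_𝒦 = 2M_φM_φ′·2δ`, `k_{Q,k} = |a|·M_φ′M_φe^{100d(d+1)L^dA}·2d·(C_Q∕√c₁)·2(2d+1)√(c₀·d·(L^{n+1})^d)`** — the
# tower twin of ne9-leaf-05's (K56) `B9Eq326LocalPartZerothOrderCoshRow` (there: the one-step averaging `Q(U)`, near blocks `d_m ≤ 2`, ratio `e^{θd(3L−1)}`; here:
# the composite `Q_k(U)` through this lineage's STENCIL letter (PSK) — `2d+1` big blocks at block distance `≤ 1`, ratio `e^{θd(2L^{n+1}−1)}`, block `L²` norm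
# against the fibre sup `√(c₀·d·(L^{n+1})^d) = √(d·c₁)` on the diagonal: NO power of the height at `θ = κ₀η`) — the `hPuv` slot of this lineage's
# `B9Eq326LocalPartTowerDivergenceRow` (the OWNER t4-ne9-p1's PRE-INTENT-6 (DVT), journal l.65114, taken by this seat l.65169)

statement-level skeleton of published theorems with citation tags; proofs where landed; nothing here is a claim about the Yang–Mills mass gap

CITATION HEADER (lean-in-tree rule).  Audit cell `pub-balaban`, sub-cell `t4`, BINDER row NE9; filed by NE9 crux-team LEAF PROVER 03 (`b2b-balaban-t4-ne9-formalise-leaf-03`,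
gen 79; road ΔA-CT).  Imports ne9-leaf-05's (K56) `B9Eq326LocalPartZerothOrderCoshRow` (`prod_cosh_le_exp_mul_prod_cosh`; through it (K47)
`B9Eq326LocalPartZerothOrderWeightedRow`, (K38) `B9Eq342GradientRowNaturalPerturbation`, `B9Eq326LocalPartKatoForm`) and this lineage's (ECL)
`B9Eq326LocalPartTowerSupDecayDiagonalClosed` (`sum_bondMass_bigBlock_le`; through it (PSK) `B9Eq316PenaltyStencilLetterTower`, `B9Eq342TowerBigBlocks`, (K59)
`B9Eq326WeitzenbockHolonomyLetter`, `B9Eq347LocalFromBlockDecay`, `B9Eq326OperatorTower`).  SOURCE READ first-hand in the held text layers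
[Balaban1985BackgroundPropagators] (`paper:balaban1985-cmp99-background-propagators`, journal page = PDF page + 388): p. 395 (3.26); p. 404 (3.69); p. 393 (3.16);
p. 392 (3.10)–(3.11); p. 399 (3.49); [Balaban1985Averaging] (`paper:balaban1985-cmp98-averaging`) p. 24 *«this definition is local»*, pp. 36–37 (125)–(127);
[Balaban1985Variational] p. 298 (134)–(136); [Balaban1984PropagatorsI] p. 36.  [folklore] composition BY NAME; nothing printed is a hypothesis except the model
letters; the `[cite: …]` tags are TEXT LOCATIONS.

WHAT IS PROVED (sorry-free; proof lane — 0 `def`; [folklore]).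
* §0 **`prod_cosh_le_exp_mul_prod_cosh_of_bigBlockNear`** — on `T_{(L^{n+1}m)}` (`1 ≤ m_i`), `0 ≤ θ`: `d_m(Πx, Πx′) ≤ s ⟹ W_y(x′) ≤ e^{θ·d·(L^{n+1}s + (L^{n+1}−1))}·W_y(x)`
  ((K56) §1 with this lineage's `B9Eq342TowerBigBlocks.tdist_le_mul_tdist_bigBlock_add`); **`norm_bondBlock_le_sqrt_mul_tower`** — for the big-block bond family
  `P_y` given pointwise: `‖g(b)‖ ≤ M` over `Π⁻¹(v)` ⟹ `‖P_vg‖ ≤ √(c₀·d·(L^{n+1})^d)·M` (`B9Eq347LocalFromBlockDecay.norm_le_sqrt_mass_mul` at (ECL) §1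
  `sum_bondMass_bigBlock_le` — the bond twin of this lineage's `B9Eq324PenaltyBlockLocal.norm_block_le_sqrt_mul_tower`).
* §1 **`norm_penalty_QkW_apply_le_weighted_tower`** — the tower penalty row in the `cosh` currency (the display above): (PSK) `norm_penalty_QkW_apply_le_stencil`
  (`tdist_stencil_le_one`), each block norm by §0, through (K47) §1 `weighted_row_of_local_letter` with §0's near-block ratio at `s = 1`;
  **`norm_zerothOrder_apply_le_weighted_cosh_tower`** — the `hPuv` shape: for every centre `y` and `N_u ≥ 0`, the value row implies the `P`-row with the constant
  `c_P` ((K47) §4 `norm_zerothOrder_apply_le_weighted` — generic `Pd`, generic `Q` — at `Q := Q_k(U) = QkW`, `E := e^{θ}` by (K38) `weight_site_shift_le` ∕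
  `weight_site_unshift_le`, `N_Q` from §1, the holonomy letter `δ_𝒦 = 2M_φM_φ′·2δ` of `𝒦` by (K59) `holonomy_letter` from the plaquette letters `δ`).
HONEST SCOPE.  Composition only; the plaquette smallness `δ`, the `Q_k` regularity letters (`α_j ≤ 1∕64`, `U_j(b) ∈ U1`, `ε_j ≤ ε_s r^j`, the loop window
`Σ_{j<n+1}α_j ≤ A`), the diagonal `c₀(L^{n+1})^d = c₁`, (T) and the fibre data stay DISPLAYED (the model's letters); crude constants (the factor `2(2d+1)`, `L^d`
in the exponent of `k_{Q,k}`); the ratio `e^{θd(2L^{n+1}−1)}` and `√(c₀·d·(L^{n+1})^d)` are displayed as they fall (height-free only at `θ = κ₀η` on the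
diagonal — the consumer's reading); nothing of [B9] Thm 3.1∕3.3∕3.11 is asserted, valued or discharged.  NOT NE9 (cell pub-balaban: NE9 NOT PRINTED ∕ NOT PROVED;
«NE9 ⇐ the named binders»; row WALLED ON A MODEL (O-NE9-1; #5 UNRULED); spine PROVED 0∕9; rung (B)+1 on a finite T⁴ — NOT infinite volume, NOT mass gap, NOT
BetaPertH, NOT Clay; HONEST DEPENDENCY: continuum YM on T⁴ ⇐ BetaPertH ∧ nine spine estimates (0/9 proved); BetaPertH ⇐ (D1) ∧ (D4) ∧ CAP+tail; G-an2-4 gates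
asym, D1 and NE2/3/4).  NEW file; nothing modified.  Net new unproved facts: 0.
-/

noncomputable section

set_option autoImplicit false

open scoped BigOperators InnerProductSpace

namespace Literature.MathematicalPhysics.QuantumFieldTheory.Balaban1983to89.B9Eq326LocalPartTowerZerothOrderCoshRow

open B4Sect5Torus (TSite tdist)
open B4TorusKernel.MultiPeriod (circAbs)
open B9SectCLatticeCarrier (Bond DirPair shift unshift)
open B9Eq311L2Pairing (WL2)
open B11Eq103H1Complex (BondL2K)
open B9Eq310HessianOperator (adTransportW curvOp)
open B9Eq310DeltaPrime (reHol imHol)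
open B7Prop1Explicit (U1 Wcx boxVec)
open B9Eq319QprimeTorus (fineP blockCoord)
open B9Eq315QTorus (perCfg cornerSite)
open B9Eq315QTower (towerP UlevOf)
open B9Eq316TowerFlatIsOneStep (towerP_eq_fineP_pow siteCast)
open B9Eq326OperatorTower (QkW)
open B9Eq326LocalPartKatoForm (weitzOpK)
open B9Eq342GradientRowNaturalPerturbation (weight_site_shift_le weight_site_unshift_le)
open B9Eq342TowerBigBlocks (tdist_le_mul_tdist_bigBlock_add)
open B9Eq326LocalPartZerothOrderWeightedRow (weighted_row_of_local_letter norm_zerothOrder_apply_le_weighted)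
open B9Eq326LocalPartZerothOrderCoshRow (prod_cosh_le_exp_mul_prod_cosh)
open B9Eq316PenaltyStencilLetterTower (norm_penalty_QkW_apply_le_stencil tdist_stencil_le_one)
open B9Eq347LocalFromBlockDecay (norm_le_sqrt_mass_mul)
open B9Eq326LocalPartTowerSupDecayDiagonalClosed (sum_bondMass_bigBlock_le)
open B9Eq326WeitzenbockHolonomyLetter (holonomy_letter)

/-! ## §0 The tower's `cosh` currency on bonds: the near-block weight ratio and the bond-block mass -/

section Currency

variable {d : ℕ} (L : ℕ) [NeZero L] (m : Fin d → ℕ) [∀ i, NeZero (m i)] (n : ℕ)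

/-- **ACROSS NEAR BIG BLOCKS**: on the tower's fine torus `T_{(L^{n+1}m)}` (`1 ≤ m_i`), `0 ≤ θ`, `d_m(Πx, Πx′) ≤ s` ⟹
`W_y(x′) ≤ e^{θ·d·(L^{n+1}s + (L^{n+1}−1))}·W_y(x)` for the product-`cosh` site weight of rate `θ` — ne9-leaf-05's `prod_cosh_le_exp_mul_prod_cosh` with
this lineage's `B9Eq342TowerBigBlocks.tdist_le_mul_tdist_bigBlock_add` (the tower twin of `prod_cosh_le_exp_mul_prod_cosh_of_blockNear`; height-free exactly at
`θ = κ₀∕L^{n+1}`). [folklore] [cite: Balaban1985BackgroundPropagators, (3.69) p.404, (3.49) p.399; Balaban1985Averaging, (2) p.17; Balaban1984PropagatorsI, p.36] -/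
theorem prod_cosh_le_exp_mul_prod_cosh_of_bigBlockNear (hm : ∀ i, 1 ≤ m i) {θ : ℝ} (hθ : 0 ≤ θ) {s : ℝ}
    (y x x' : TSite d (towerP L m (n + 1)))
    (hs : tdist m (blockCoord (L ^ (n + 1)) m (siteCast (towerP_eq_fineP_pow L m (n + 1)) x))
      (blockCoord (L ^ (n + 1)) m (siteCast (towerP_eq_fineP_pow L m (n + 1)) x')) ≤ s) :
    (∏ μ, Real.cosh (θ * (circAbs (towerP L m (n + 1) μ)
        (ZMod.val (((y μ : ℕ) : ZMod (towerP L m (n + 1) μ)) - ((x' μ : ℕ) : ZMod (towerP L m (n + 1) μ)))) : ℝ))) ≤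
      Real.exp (θ * (d : ℝ) * ((L : ℝ) ^ (n + 1) * s + ((L : ℝ) ^ (n + 1) - 1))) *
        ∏ μ, Real.cosh (θ * (circAbs (towerP L m (n + 1) μ)
          (ZMod.val (((y μ : ℕ) : ZMod (towerP L m (n + 1) μ)) - ((x μ : ℕ) : ZMod (towerP L m (n + 1) μ)))) : ℝ)) := by
  refine (prod_cosh_le_exp_mul_prod_cosh hθ y x x').trans (mul_le_mul_of_nonneg_right (Real.exp_le_exp.2 ?_)
    (Finset.prod_nonneg fun μ _ => (Real.cosh_pos _).le))
  have h1 := tdist_le_mul_tdist_bigBlock_add L m (n + 1) hm x x'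
  have hL : (0 : ℝ) ≤ (L : ℝ) ^ (n + 1) := by positivity
  have h2 : tdist (towerP L m (n + 1)) x x' ≤ (L : ℝ) ^ (n + 1) * s + ((L : ℝ) ^ (n + 1) - 1) := h1.trans (by nlinarith)
  exact mul_le_mul_of_nonneg_left h2 (by positivity)

variable {W : Type*} [NormedAddCommGroup W] [InnerProductSpace ℂ W] {c₀ : ℝ} [Fact (0 < c₀)]
  {PB : TSite d m → BondL2K ℂ d (towerP L m (n + 1)) c₀ W →L[ℂ] BondL2K ℂ d (towerP L m (n + 1)) c₀ W}
  (hPB : ∀ (y : TSite d m) (f : BondL2K ℂ d (towerP L m (n + 1)) c₀ W) (b : Bond d (towerP L m (n + 1))),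
    WL2.equiv ℂ (fun _ : Bond d (towerP L m (n + 1)) => c₀) W (PB y f) b =
      if blockCoord (L ^ (n + 1)) m (siteCast (towerP_eq_fineP_pow L m (n + 1)) b.1) = y then
        WL2.equiv ℂ (fun _ : Bond d (towerP L m (n + 1)) => c₀) W f b else 0)

omit [∀ i, NeZero (m i)] in
include hPB in
/-- **THE BOND-BLOCK `L²` NORM AGAINST THE FIBRE SUP AT THE TOWER**: `‖g(b)‖ ≤ M` on the bonds over the big block `v` (`0 ≤ M`) ⟹
`‖P_vg‖ ≤ √(c₀·d·(L^{n+1})^d)·M` — `B9Eq347LocalFromBlockDecay.norm_le_sqrt_mass_mul` at the bond-block mass `sum_bondMass_bigBlock_le` (on the diagonal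
`c₀(L^{n+1})^d = c₁` this is `√(d·c₁)·M`, free of the height; the bond twin of this lineage's `B9Eq324PenaltyBlockLocal.norm_block_le_sqrt_mul_tower`).
[folklore] [cite: Balaban1985BackgroundPropagators, (3.11) p.392, (3.49) p.399; Balaban1985Averaging, (2) p.17] -/
theorem norm_bondBlock_le_sqrt_mul_tower (v : TSite d m) (g : BondL2K ℂ d (towerP L m (n + 1)) c₀ W) {M : ℝ} (hM : 0 ≤ M)
    (hg : ∀ b : Bond d (towerP L m (n + 1)), blockCoord (L ^ (n + 1)) m (siteCast (towerP_eq_fineP_pow L m (n + 1)) b.1) = v →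
      ‖WL2.equiv ℂ (fun _ : Bond d (towerP L m (n + 1)) => c₀) W g b‖ ≤ M) :
    ‖PB v g‖ ≤ Real.sqrt (c₀ * (d * ((L : ℝ) ^ (n + 1)) ^ d)) * M := by
  have hc₀ : 0 < c₀ := Fact.out
  refine norm_le_sqrt_mass_mul v (sum_bondMass_bigBlock_le L m n hc₀.le v) (PB v g) hM (fun b hb => ?_) (fun b => ?_)
  · rw [hPB, if_neg hb]
  · rw [hPB]
    split_ifs with hb
    · exact hg b hb
    · rw [norm_zero]; exact hM

end Currency

/-! ## §1 The tower penalty `Q_k(U)†(a•Q_k(U))` and the zeroth-order part of `A₀,k` in the `cosh` currency -/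

section ZerothOrder

variable {d : ℕ} (L : ℕ) [NeZero L] (m : Fin d → ℕ) [∀ i, NeZero (m i)] (n : ℕ)
  {𝔸 : Type*} [NormedRing 𝔸] [StarRing 𝔸] [NormedAlgebra ℂ 𝔸] [StarModule ℂ 𝔸] [CompleteSpace 𝔸] [NormOneClass 𝔸]
  {W : Type*} [NormedAddCommGroup W] [InnerProductSpace ℂ W] [FiniteDimensional ℂ W] (φ : W ≃ₗ[ℂ] 𝔸) {c₀ c₁ : ℝ} [Fact (0 < c₀)] [Fact (0 < c₁)]
  (U : Bond d (towerP L m (n + 1)) → 𝔸ˣ) (hL : 1 ≤ L) (α : ℕ → ℝ) (hα0 : ∀ j, 0 ≤ α j) (hα1 : ∀ j, α j ≤ 1 / 64)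
  (hU1 : ∀ (j : ℕ) (x : B7Prop1Explicit.Site d) (k : Fin d), perCfg (towerP L m (j + 1)) (UlevOf L m (n + 1) U j) x k ∈ U1 𝔸)
  (hreg : ∀ (j : ℕ) (y : TSite d (towerP L m j)) (k : Fin d) (ρ : Fin d → Fin L),
    ‖((Wcx L (perCfg (towerP L m (j + 1)) (UlevOf L m (n + 1) U j)) (cornerSite L y) k (boxVec L ρ) : 𝔸ˣ) : 𝔸) - 1‖ ≤ α j)
  {Mφ Mφ' : ℝ} (hMφ : 0 ≤ Mφ) (hφ : ∀ w, ‖φ w‖ ≤ Mφ * ‖w‖) (hMφ' : 0 ≤ Mφ') (hφ' : ∀ X, ‖φ.symm X‖ ≤ Mφ' * ‖X‖) (hstar : ∀ X : 𝔸, ‖star X‖ ≤ ‖X‖)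
  (εU : ℕ → ℝ) (hεU : ∀ j, 0 ≤ εU j)
  (hUε : ∀ (j : ℕ) (b : Bond d (towerP L m (j + 1))), ‖(UlevOf L m (n + 1) U j b : 𝔸) - 1‖ ≤ εU j)
  {r εs : ℝ} (hr0 : 0 ≤ r) (hr1 : r < 1) (hεs : 0 ≤ εs) (hεg : ∀ j < n + 1, εU j ≤ εs * r ^ j)
  (τ : 𝔸 →ₗ[ℂ] ℂ) {Mτ : ℝ} (hτ : ∀ X Y : 𝔸, ‖τ (X * Y)‖ ≤ Mτ * ‖X‖ * ‖Y‖) (hMτ : 0 ≤ Mτ)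
  (η : ℝ) (hUb : ∀ b, U b ∈ U1 𝔸) {δ : ℝ} (hδ : 0 ≤ δ)
  (hRe : ∀ p : B9SectCLatticeCarrier.Plaq d (towerP L m (n + 1)), ‖reHol U p - 1‖ ≤ δ)
  (hIm : ∀ p : B9SectCLatticeCarrier.Plaq d (towerP L m (n + 1)), ‖imHol U p‖ ≤ δ)
  {PB : TSite d m → BondL2K ℂ d (towerP L m (n + 1)) c₀ W →L[ℂ] BondL2K ℂ d (towerP L m (n + 1)) c₀ W}
  (hPB : ∀ (y : TSite d m) (f : BondL2K ℂ d (towerP L m (n + 1)) c₀ W) (b : Bond d (towerP L m (n + 1))),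
    WL2.equiv ℂ (fun _ : Bond d (towerP L m (n + 1)) => c₀) W (PB y f) b =
      if blockCoord (L ^ (n + 1)) m (siteCast (towerP_eq_fineP_pow L m (n + 1)) b.1) = y then
        WL2.equiv ℂ (fun _ : Bond d (towerP L m (n + 1)) => c₀) W f b else 0)
  (θ : ℝ)


omit [StarRing 𝔸] [StarModule ℂ 𝔸] in
include hα0 hMφ hφ hMφ' hφ' hεU hUε hr0 hr1 hεs hεg hPB in
/-- **THE TOWER PENALTY ROW IN THE `cosh` CURRENCY** (tower twin of (K56) §2): on the diagonal `c₀(L^{n+1})^d = c₁`, with the loop window `Σ_{j<n+1}α_j ≤ A`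
and the geometric bond window, `‖u(b′)‖ ≤ N_u·W_y(b′₋)` on every bond (`0 ≤ N_u`) ⟹
`‖((Q_k(U)†(a•Q_k(U)))u)(b)‖ ≤ k_{Q,k}·e^{θ·d·(L^{n+1}·1 + (L^{n+1}−1))}·N_u·W_y(b₋)`,
`k_{Q,k} = |a|·(M_φ′M_φe^{100d(d+1)L^dA}·2d·(C_Q∕√c₁·(2·((2d+1)·√(c₀·d·(L^{n+1})^d)))))` — this lineage's (PSK) STENCIL letter
`norm_penalty_QkW_apply_le_stencil` (the penalty at `b` reads `u` over the `2d+1` big blocks at block distance `≤ 1` of `Π(b₋)`), each block `L²` norm against the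
fibre sup by §0 `norm_bondBlock_le_sqrt_mul_tower`, through ne9-leaf-05's `weighted_row_of_local_letter` with the near-block ratio of §0 (`s = 1`).  On the diagonal
`√(c₀·d·(L^{n+1})^d)∕√c₁ = √d`: NO power of the height. [folklore]
[cite: Balaban1985BackgroundPropagators, (3.16) p.393, (3.26) p.395, (3.69) p.404, (3.49) p.399; Balaban1985Averaging, p.24, (125)–(127) pp.36–37; Balaban1984PropagatorsI, p.36] -/
theorem norm_penalty_QkW_apply_le_weighted_tower [DecidableEq (Bond d (towerP L m (n + 1)))] (hm : ∀ i, 1 ≤ m i)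
    {A : ℝ} (hA : ∑ j ∈ Finset.range (n + 1), α j ≤ A) (hw : c₀ * ((L : ℝ) ^ (n + 1)) ^ d = c₁) (hθ : 0 ≤ θ)
    (a : ℝ) (u : BondL2K ℂ d (towerP L m (n + 1)) c₀ W) (y : TSite d (towerP L m (n + 1))) {Nu : ℝ} (hNu : 0 ≤ Nu)
    (hv : ∀ b : Bond d (towerP L m (n + 1)), ‖WL2.equiv ℂ (fun _ : Bond d (towerP L m (n + 1)) => c₀) W u b‖ ≤ Nu *
        (fun x : TSite d (towerP L m (n + 1)) => ∏ μ, Real.cosh (θ * (circAbs (towerP L m (n + 1) μ)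
          (ZMod.val (((y μ : ℕ) : ZMod (towerP L m (n + 1) μ)) - ((x μ : ℕ) : ZMod (towerP L m (n + 1) μ)))) : ℝ))) b.1)
    (b : Bond d (towerP L m (n + 1))) :
    ‖WL2.equiv ℂ (fun _ : Bond d (towerP L m (n + 1)) => c₀) W
        ((LinearMap.adjoint (QkW L m n φ U hL α hα1 hU1 hreg (c₀ := c₀) (c₁ := c₁)) ∘ₗ
          ((a : ℂ) • QkW L m n φ U hL α hα1 hU1 hreg (c₀ := c₀) (c₁ := c₁))) u) b‖ ≤
      |a| * (Mφ' * Mφ * Real.exp (100 * d * (d + 1) * (L : ℝ) ^ d * A) * ((2 * d : ℕ) : ℝ) *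
          ((Mφ' * Mφ * Real.exp (Real.sqrt ((L : ℝ) ^ d) * (Real.sqrt (2 * d) * (102 * (d + 1) ^ 2 * L)) * (εs / (1 - r)))) / Real.sqrt c₁ *
            (2 * ((Fintype.card (Option (Fin d × Bool)) : ℝ) * (Real.sqrt (c₀ * (d * ((L : ℝ) ^ (n + 1)) ^ d))))))) *
        Real.exp (θ * (d : ℝ) * ((L : ℝ) ^ (n + 1) * 1 + ((L : ℝ) ^ (n + 1) - 1))) * Nu *
            (fun x : TSite d (towerP L m (n + 1)) => ∏ μ, Real.cosh (θ * (circAbs (towerP L m (n + 1) μ)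
              (ZMod.val (((y μ : ℕ) : ZMod (towerP L m (n + 1) μ)) - ((x μ : ℕ) : ZMod (towerP L m (n + 1) μ)))) : ℝ))) b.1 := by
  have hc₀ : 0 < c₀ := Fact.out
  refine weighted_row_of_local_letter
    (fun b => WL2.equiv ℂ (fun _ : Bond d (towerP L m (n + 1)) => c₀) W
      ((LinearMap.adjoint (QkW L m n φ U hL α hα1 hU1 hreg (c₀ := c₀) (c₁ := c₁)) ∘ₗ
        ((a : ℂ) • QkW L m n φ U hL α hα1 hU1 hreg (c₀ := c₀) (c₁ := c₁))) u) b)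
    (fun b => WL2.equiv ℂ (fun _ : Bond d (towerP L m (n + 1)) => c₀) W u b) (fun b : Bond d (towerP L m (n + 1)) =>
        (fun x : TSite d (towerP L m (n + 1)) => ∏ μ, Real.cosh (θ * (circAbs (towerP L m (n + 1) μ)
          (ZMod.val (((y μ : ℕ) : ZMod (towerP L m (n + 1) μ)) - ((x μ : ℕ) : ZMod (towerP L m (n + 1) μ)))) : ℝ))) b.1)
    (fun b b' : Bond d (towerP L m (n + 1)) => tdist m (blockCoord (L ^ (n + 1)) m (siteCast (towerP_eq_fineP_pow L m (n + 1)) b.1)) (blockCoord (L ^ (n + 1)) m (siteCast (towerP_eq_fineP_pow L m (n + 1)) b'.1)) ≤ 1) (Real.exp_pos _).le hNu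
    (fun b => Finset.prod_nonneg fun μ _ => (Real.cosh_pos _).le) (fun b M hM hloc => ?_) hv (fun b b' hbb' => ?_) b
  · -- the stencil letter, each block norm against the near sup `M`
    have h := norm_penalty_QkW_apply_le_stencil L m n φ U hL α hα0 hα1 hU1 hreg hMφ hφ hMφ' hφ' εU hεU hUε hr0 hr1 hεs hεg hPB hA hw a u b
    have hblk : ∀ i : Option (Fin d × Bool),
        ‖PB (Option.elim i (blockCoord (L ^ (n + 1)) m (siteCast (towerP_eq_fineP_pow L m (n + 1)) b.1)) (fun p => if p.2 then shift p.1 (blockCoord (L ^ (n + 1)) m (siteCast (towerP_eq_fineP_pow L m (n + 1)) b.1)) else unshift p.1 (blockCoord (L ^ (n + 1)) m (siteCast (towerP_eq_fineP_pow L m (n + 1)) b.1)))) u‖ ≤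
          Real.sqrt (c₀ * (d * ((L : ℝ) ^ (n + 1)) ^ d)) * M := fun i =>
      norm_bondBlock_le_sqrt_mul_tower L m n hPB _ u hM fun b' hb' => hloc b' (by
        have hst := tdist_stencil_le_one m hm (blockCoord (L ^ (n + 1)) m (siteCast (towerP_eq_fineP_pow L m (n + 1)) b.1)) i
        rw [← hb'] at hst
        exact hst)
    have hsum : ∑ i : Option (Fin d × Bool),
        ‖PB (Option.elim i (blockCoord (L ^ (n + 1)) m (siteCast (towerP_eq_fineP_pow L m (n + 1)) b.1)) (fun p => if p.2 then shift p.1 (blockCoord (L ^ (n + 1)) m (siteCast (towerP_eq_fineP_pow L m (n + 1)) b.1)) else unshift p.1 (blockCoord (L ^ (n + 1)) m (siteCast (towerP_eq_fineP_pow L m (n + 1)) b.1)))) u‖ ≤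
          (Fintype.card (Option (Fin d × Bool)) : ℝ) * (Real.sqrt (c₀ * (d * ((L : ℝ) ^ (n + 1)) ^ d)) * M) := by
      calc _ ≤ ∑ _i : Option (Fin d × Bool), Real.sqrt (c₀ * (d * ((L : ℝ) ^ (n + 1)) ^ d)) * M := Finset.sum_le_sum fun i _ => hblk i
        _ = _ := by rw [Finset.sum_const, Finset.card_univ, nsmul_eq_mul]
    have hK : 0 ≤ |a| * (Mφ' * Mφ * Real.exp (100 * d * (d + 1) * (L : ℝ) ^ d * A) * ((2 * d : ℕ) : ℝ) *
        ((Mφ' * Mφ * Real.exp (Real.sqrt ((L : ℝ) ^ d) * (Real.sqrt (2 * d) * (102 * (d + 1) ^ 2 * L)) * (εs / (1 - r)))) / Real.sqrt c₁ * 2)) := by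
      positivity
    calc _ ≤ _ := h
      _ = |a| * (Mφ' * Mφ * Real.exp (100 * d * (d + 1) * (L : ℝ) ^ d * A) * ((2 * d : ℕ) : ℝ) *
          ((Mφ' * Mφ * Real.exp (Real.sqrt ((L : ℝ) ^ d) * (Real.sqrt (2 * d) * (102 * (d + 1) ^ 2 * L)) * (εs / (1 - r)))) / Real.sqrt c₁ * 2)) *
          ∑ i : Option (Fin d × Bool),
            ‖PB (Option.elim i (blockCoord (L ^ (n + 1)) m (siteCast (towerP_eq_fineP_pow L m (n + 1)) b.1)) (fun p => if p.2 then shift p.1 (blockCoord (L ^ (n + 1)) m (siteCast (towerP_eq_fineP_pow L m (n + 1)) b.1)) else unshift p.1 (blockCoord (L ^ (n + 1)) m (siteCast (towerP_eq_fineP_pow L m (n + 1)) b.1)))) u‖ := by ring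
      _ ≤ |a| * (Mφ' * Mφ * Real.exp (100 * d * (d + 1) * (L : ℝ) ^ d * A) * ((2 * d : ℕ) : ℝ) *
          ((Mφ' * Mφ * Real.exp (Real.sqrt ((L : ℝ) ^ d) * (Real.sqrt (2 * d) * (102 * (d + 1) ^ 2 * L)) * (εs / (1 - r)))) / Real.sqrt c₁ * 2)) *
          ((Fintype.card (Option (Fin d × Bool)) : ℝ) * (Real.sqrt (c₀ * (d * ((L : ℝ) ^ (n + 1)) ^ d)) * M)) :=
          mul_le_mul_of_nonneg_left hsum hK
      _ = _ := by ring
  · exact prod_cosh_le_exp_mul_prod_cosh_of_bigBlockNear L m n hm hθ y b.1 b'.1 hbb'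

include hα0 hMφ hφ hMφ' hφ' hstar hεU hUε hr0 hr1 hεs hεg hτ hMτ hUb hδ hRe hIm hPB in
/-- **THE ROW OF THE ZEROTH-ORDER PART `P = Δ′ + Q_k(U)†(a•Q_k(U)) − κ•𝒦` OF THE TOWER LOCAL PART IN THE `cosh` CURRENCY, `hPuv` SHAPE** (tower twin of
(K56) §3): for every centre `y` and `N_u ≥ 0`, `‖u(b)‖ ≤ N_u·W_y(b₋)` on every bond ⟹ `‖(Pu)(b)‖ ≤ (c_P·N_u)·W_y(b₋)`,
`c_P = p_K·e^{2θ} + k_{Q,k}·e^{θd(2L^{n+1}−1)} + ‖κ‖·(d−1)·δ_𝒦·e^{2θ}`, `p_K = 768·|DirPair d|·M_τ·M_φ²·(‖η^d‖∕c₀)·‖η⁻¹‖²·δ`, `δ_𝒦 = 2M_φM_φ′·2δ` —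
ne9-leaf-05's (K47) §4 `norm_zerothOrder_apply_le_weighted` (generic `Pd`, generic `Q`) at `Q := Q_k`, the one-step ratios `e^{θ}` ((K38)), the penalty row
above, the holonomy letter of `𝒦` by (K59) `holonomy_letter` from the plaquette letters `δ`. [folklore]
[cite: Balaban1985BackgroundPropagators, (3.26) p.395, (3.69) p.404, (3.10)–(3.11) p.392, (3.16) p.393; Balaban1985Variational, (134)–(136) p.298] -/
theorem norm_zerothOrder_apply_le_weighted_cosh_tower [DecidableEq (Bond d (towerP L m (n + 1)))] (hm : ∀ i, 1 ≤ m i)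
    {A : ℝ} (hA : ∑ j ∈ Finset.range (n + 1), α j ≤ A) (hw : c₀ * ((L : ℝ) ^ (n + 1)) ^ d = c₁) (hθ : 0 ≤ θ)
    (hR : ∀ (b : Bond d (towerP L m (n + 1))) (w : W), ‖adTransportW φ U b w‖ ≤ ‖w‖)
    (hS : ∀ (b : Bond d (towerP L m (n + 1))) (w : W), ‖adTransportW φ (fun bb => (U bb)⁻¹) b w‖ ≤ ‖w‖)
    (a : ℝ) (κ : ℂ) (u : BondL2K ℂ d (towerP L m (n + 1)) c₀ W) (y : TSite d (towerP L m (n + 1))) (Nu : ℝ) (hNu : 0 ≤ Nu)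
    (hv : ∀ b : Bond d (towerP L m (n + 1)), ‖WL2.equiv ℂ (fun _ : Bond d (towerP L m (n + 1)) => c₀) W u b‖ ≤ Nu *
        (fun x : TSite d (towerP L m (n + 1)) => ∏ μ, Real.cosh (θ * (circAbs (towerP L m (n + 1) μ)
          (ZMod.val (((y μ : ℕ) : ZMod (towerP L m (n + 1) μ)) - ((x μ : ℕ) : ZMod (towerP L m (n + 1) μ)))) : ℝ))) b.1)
    (b : Bond d (towerP L m (n + 1))) :
    ‖WL2.equiv ℂ (fun _ : Bond d (towerP L m (n + 1)) => c₀) W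
        ((curvOp φ τ η U + LinearMap.adjoint (QkW L m n φ U hL α hα1 hU1 hreg (c₀ := c₀) (c₁ := c₁)) ∘ₗ
            ((a : ℂ) • QkW L m n φ U hL α hα1 hU1 hreg (c₀ := c₀) (c₁ := c₁)) -
          κ • weitzOpK ℂ c₀ (adTransportW φ U) (adTransportW φ fun b => (U b)⁻¹) :
          BondL2K ℂ d (towerP L m (n + 1)) c₀ W →ₗ[ℂ] BondL2K ℂ d (towerP L m (n + 1)) c₀ W) u) b‖ ≤
      ((768 * Fintype.card (DirPair d) * Mτ * Mφ ^ 2 * (‖((η : ℂ)) ^ d‖ / c₀) * ‖((η : ℂ))⁻¹‖ ^ 2 * δ * Real.exp θ ^ 2 +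
          |a| * (Mφ' * Mφ * Real.exp (100 * d * (d + 1) * (L : ℝ) ^ d * A) * ((2 * d : ℕ) : ℝ) *
            ((Mφ' * Mφ * Real.exp (Real.sqrt ((L : ℝ) ^ d) * (Real.sqrt (2 * d) * (102 * (d + 1) ^ 2 * L)) * (εs / (1 - r)))) / Real.sqrt c₁ *
              (2 * ((Fintype.card (Option (Fin d × Bool)) : ℝ) * (Real.sqrt (c₀ * (d * ((L : ℝ) ^ (n + 1)) ^ d))))))) *
            Real.exp (θ * (d : ℝ) * ((L : ℝ) ^ (n + 1) * 1 + ((L : ℝ) ^ (n + 1) - 1))) +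
          ‖κ‖ * ((d - 1 : ℝ) * (2 * Mφ * Mφ' * (2 * δ)) * Real.exp θ ^ 2)) * Nu) *
              (fun x : TSite d (towerP L m (n + 1)) => ∏ μ, Real.cosh (θ * (circAbs (towerP L m (n + 1) μ)
                (ZMod.val (((y μ : ℕ) : ZMod (towerP L m (n + 1) μ)) - ((x μ : ℕ) : ZMod (towerP L m (n + 1) μ)))) : ℝ))) b.1 := by
  have hU' : ∀ b, ‖(U b : 𝔸)‖ ≤ 1 ∧ ‖(((U b)⁻¹ : 𝔸ˣ) : 𝔸)‖ ≤ 1 := fun b => B7Prop1Explicit.mem_U1.mp (hUb b)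
  have hSR : ∀ (b : Bond d (towerP L m (n + 1))) (w : W), adTransportW φ (fun b => (U b)⁻¹) b (adTransportW φ U b w) = w :=
    fun b w => B9Eq342GreenPrimeSupBound.adTransportW_inv_adTransportW φ U b w
  have hRS : ∀ (b : Bond d (towerP L m (n + 1))) (w : W), adTransportW φ U b (adTransportW φ (fun b => (U b)⁻¹) b w) = w := fun b w => by
    have h := B9Eq342GreenPrimeSupBound.adTransportW_inv_adTransportW φ (fun b => (U b)⁻¹) b w
    simp only [inv_inv] at h
    exact h
  have hδK : 0 ≤ 2 * Mφ * Mφ' * (2 * δ) := by positivity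
  have hHol : ∀ (x : TSite d (towerP L m (n + 1))) (μ ν : Fin d), μ ≠ ν → ∀ w : W,
      ‖adTransportW φ (fun b => (U b)⁻¹) (unshift ν x, ν) (adTransportW φ U (unshift ν x, μ) w) -
          adTransportW φ U (x, μ) (adTransportW φ (fun b => (U b)⁻¹) (shift μ (unshift ν x), ν) w)‖ ≤ 2 * Mφ * Mφ' * (2 * δ) * ‖w‖ :=
    fun x μ ν hne w => holonomy_letter U hUb hRe hIm φ hφ hφ' hMφ hMφ' hR hS x μ ν hne w
  have hQ := fun b' => norm_penalty_QkW_apply_le_weighted_tower L m n φ U hL α hα0 hα1 hU1 hreg hMφ hφ hMφ' hφ' εU hεU hUε hr0 hr1 hεs hεg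
    hPB θ hm hA hw hθ a u y hNu hv b'
  have h := norm_zerothOrder_apply_le_weighted φ hφ hMφ hstar τ hτ hMτ η U hU' hδ hRe hIm
    (QkW L m n φ U hL α hα1 hU1 hreg (c₀ := c₀) (c₁ := c₁)) a κ (adTransportW φ U) (adTransportW φ fun b => (U b)⁻¹) hSR hRS hδK hHol u

        (fun x : TSite d (towerP L m (n + 1)) => ∏ μ, Real.cosh (θ * (circAbs (towerP L m (n + 1) μ)
          (ZMod.val (((y μ : ℕ) : ZMod (towerP L m (n + 1) μ)) - ((x μ : ℕ) : ZMod (towerP L m (n + 1) μ)))) : ℝ))) (E := Real.exp θ) (Real.one_le_exp hθ) hNu (fun x => Finset.prod_nonneg fun μ _ => (Real.cosh_pos _).le)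
    (fun x ν => weight_site_shift_le hθ y x ν) (fun x ν => weight_site_unshift_le hθ y x ν) hv hQ b.1 b.2
  exact h.trans (le_of_eq (by ring))

end ZerothOrder

end Literature.MathematicalPhysics.QuantumFieldTheory.Balaban1983to89.B9Eq326LocalPartTowerZerothOrderCoshRow

end
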